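import Summits.ResolutionOfSingularities.ResolutionOfSingularities.Theorems.RadicialJungCleanModelsCleanLU3CompositeCdiv
import HarnessLib

/-!
# (C-div) ASSEMBLY SKELETON v6 (CLOSED) — sub-line of `stub_cleanLU3DefectNonDiscrete` (crux stmt-ResolutionOfSingularities-15917, line `Sketch` rev 24)

**v6 (2026-08-29, lead g5): ALL FOUR STUBS LANDED and BOTH TARGETS ARE THEOREMS OF THE TREE — `Theorems/RadicialJungCleanModelsCleanLU3CompositeCdiv.lean`
(`stub_cleanLU2` + `cleanLU3Defect_of_heightOneCoarsening` + `cleanLU3Defect_of_divisorialCoarsening`); this workfile is now a RECORD: it imports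
that file and re-exports the two targets under record names (0 sorries).  History kept below.**

**v5 (2026-08-29, lead g5): ALL THREE PERSIST stubs LANDED and deleted from this file — `stub_persistCases` (✓ p709767 `…CompositePersistCases`, over
✓ p709506 `…CompositePersistPrelims`), `stub_persistE1` + `stub_persistE2` (✓ `…CompositePersistFirstOrder`, over ✓ p710291 `…CompositePersistFibre`);
ONE sorry remains = `stub_cleanLU2` (D2, seat res-B-cdiv-w3).  Both targets are kernel-checked modulo `hEmb` (F-32) [+ F-78] and `stub_cleanLU2`.**

**v3 (2026-08-29): the targets `cleanLU3Defect_of_heightOneCoarsening` and (NEW, mod F-78) `cleanLU3Defect_of_divisorialCoarsening` are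
KERNEL-CHECKED COMPOSITIONS through ✓ `cleanLU3Defect_of_heightOneCoarsening_of_cleanMono` / ✓ `cleanLU3Defect_of_divisorialCoarsening_of_cleanMono`
(`…CompositeAssembly.lean`) and ✓ `exists_cleanMono_stage_of_cases` (`…CompositeDownstairsCases.lean`), modulo `hEmb` and the FOUR stubs
`stub_cleanLU2`, `stub_persistCases`, `stub_persistE1`, `stub_persistE2`; the withdrawn `stub_persistStep` is deleted from this file.
v3-pre note kept for the record: `stub_persistStep` (v2/v2.1) is WITHDRAWN — suspected FALSE as registered (lead's analysis, §PERSIST v3 below, before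
the targets: the integrality r.s.p. and the clean-form r.s.p. must be DECOUPLED) — and RESHAPED into three stubs `stub_persistE1`,
`stub_persistE2`, `stub_persistCases` (section `PersistV3` below, signatures final).  The v2.1 composition of the target through
✓ `cleanLU3Defect_of_heightOneCoarsening_of` is kept verbatim until the lead lands the re-threaded downstairs/upstairs assembly
(`exists_cleanMono_stage_of_cases`, `cleanLU3Defect_of_heightOneCoarsening_of_cleanMono`; then v3 composes the target through the three new
stubs + `stub_cleanLU2`).  Seats: res-B-cdiv-w4 ⟶ `stub_persistCases` (its chart work transfers verbatim); `stub_persistE1` + `stub_persistE2`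
(one seat, shared infrastructure `S[y/x]/(x) ≅ κ(S)[X]`) WANTED.**

Lead `res-B-lead-1` g4 (2026-08-29).  OURS; nothing here proves resolution in characteristic `p`.  CRUX WORKFILE (sorries allowed), NOT a
registered skeleton: the registered stub stays ONE (`stub_cleanLU3DefectNonDiscrete`, R-lead-1 YES); every piece below lands as a
`--supports stmt-…-15917 --as helper` theorem and, when `cleanLU3Defect_of_heightOneCoarsening` is sorry-free, the lead narrows the stub.
Plan of record: `Lines/Sketch-brief-Cdiv-subline.md` rev 2 + `Lines/Sketch-memo-Cdiv-lift.md` (the ADMISSIBLE-LIFT repair).  v1 of this file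
(g3, evidence #42 on 15917) is superseded: its single downstairs stub `stub_residueCleanLU_Cdiv` did not carry the coefficient control
that the lift needs.

## Pieces (✓ = landed; ◇ = pinned below, DELEGABLE; ◆ = lead)
* ✓ frame `exists_frame_of_coarsening` (mod `hEmb`), ✓ Step 0 / dichotomy / ramified / inert / lineRep / lifts of forms / curve charts / FormOneLift.
* ◆ GLUE 1: best `v₁`-approximation data inside the frame ring: `g₀ ∼ w^p g₀ ∈ R`, `a ∈ R`, `c = t^m`, `u ∈ R ∩ O₁^×`.
* ◆ RESIDUE FRAME: `κ₁ := ResidueField O₁`, `Ō := residueValuationSubring O O₁`, `Ā :=` image of the frame model, `S̄ := locAtCentre Ā Ō` = image of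
  `R`, regular of dimension 2, every centre of `Ō` above `Ā` closed, `ū ∉ κ₁^p`, and the residue map `R ↠ S̄` with kernel `(t)`.
* ◇ `stub_cleanLU2` (D2): clean local uniformization in DIMENSION 2, unconditional (from ✓ `cleanModels_dimLETwo_of_f75c`, F-75c ✓ proved, by the
  valuative criterion — pattern `Literature/…/ResolutionLU.lean` `exists_fg_regular_of_hasResolution`).
* ◇ `stub_persistStep` (PERSIST): tracked persistence of a loosely clean representative with controlled coefficient denominators under ONE quadratic
  transform along `Ō` in dimension 2 (the three cases of ✓ 4d `cleanRegAt_of_pointBlowupCharts`, with the representative tracked; memo §2).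
* ◆ MONO: the fixed denominator `d̄` becomes unit × monomial at some later stage (✓ `exists_localRing_monomial_of_embeddedResolution hEmb` in dim 2 +
  ✓ `AbhyankarQuadraticFactorization.exists_eq_of_dominated`).
* ◆ SLICE: along the quadratic sequence `S̄_m` of `S̄` along `Ō`, models `A_m ⊇ A` with `R_m := locAtCentre A_m O` regular of dimension 3 and
  `res₁ : R_m ↠ S̄_m` with principal kernel.
* ◆ LIFT LEMMA: clean downstairs with coefficient denominators a product of regular parameters of `S̄_M` ⟹ CONCL upstairs (✓ CompositeLift,
  ✓ FormOneLift machinery generalised to `t / ∏ f_i`, ✓ `lineRep_change_of_generator`).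
* ◆ ASSEMBLY `cleanLU3Defect_of_heightOneCoarsening` (below): v2.1 — KERNEL-CHECKED COMPOSITION through ✓ `cleanLU3Defect_of_heightOneCoarsening_of`
  (`Theorems/RadicialJungCleanModelsCleanLU3CompositeUpstairs.lean`; chain GlueOne → Residue → ResidueFrame → Slice → LiftPrelims/Iter/Main →
  MonoDim/Mono → Downstairs → Upstairs, all ✓ helpers), modulo `hEmb` and the two stubs above; binder `(hO₁ : O₁ ≠ ⊤)` added (critic SIG-NIT
  06:24Z).  F1-prelim (general divisorial coarsening ⟹ height-one centre on a regular model, mod F-78) is a separate later theorem.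
-/

noncomputable section

set_option linter.dupNamespace false

open IsLocalRing AlgebraicGeometry CategoryTheory
open Literature.AlgebraicGeometry.Resolution

namespace Summit.ResolutionOfSingularities.ResolutionOfSingularities.Theorems.RadicialJung.CleanModels.CdivRecord

/-- RECORD (v6): the height-one (C-div) target is the tree theorem ✓ `cleanLU3Defect_of_heightOneCoarsening` (mod F-32 `hEmb`). [folklore] -/
theorem Cdiv_heightOne_closed
    (hEmb : ∀ (Z : Scheme.{0}) [IsIntegral Z] [IsNoetherian Z], Scheme.IsRegular Z →
      Scheme.IsExcellent Z → ∀ (X : Set Z), IsClosed X → X ≠ Set.univ → topologicalKrullDim X ≤ 2 →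
        ∃ (Z' : Scheme.{0}) (π : Z' ⟶ Z), IsProper π ∧ Function.Surjective π.base ∧
          (∃ U : Z.Opens, (U : Set Z) = Xᶜ ∧ IsIso (π ∣_ U)) ∧
          IsStrictNormalCrossingsDivisor Z' (π.base ⁻¹' X))
    (p : ℕ) (hp : p.Prime) (k : Type) [Field k] [CharP k p] (K : Type) [Field K] [Algebra k K]
    (O : ValuationSubring K) (A : Subalgebra k K) (hAO : A.toSubring ≤ O.toSubring) (hAfg : A.FG)
    (hfrac : IsFractionRing A K)
    (hreg : IsRegularLocalRing (locAtCentre A.toSubring O))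
    (hdim3 : ringKrullDim (locAtCentre A.toSubring O) = 3)
    (hzd : ∀ (T : Subring K) (hT : T ≤ O.toSubring), A.toSubring ≤ T → (subringCentre T O hT).IsMaximal)
    (g₀ : K) (hg₀ : ∀ c : K, c ^ p ≠ g₀)
    (hdefect : ∀ f₀ : K, ∃ f₁ : K, O.valuation (g₀ - f₁ ^ p) < O.valuation (g₀ - f₀ ^ p))
    (O₁ : ValuationSubring K) (hOO₁ : O ≤ O₁) (hO₁ : O₁ ≠ ⊤)
    (hloc : locAtCentre (locAtCentre A.toSubring O) O₁ = O₁.toSubring) :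
    ∃ (A' : Subalgebra k K), A'.toSubring ≤ O.toSubring ∧ A ≤ A' ∧ A'.FG ∧
    ∃ (_ : IsRegularLocalRing (locAtCentre A'.toSubring O)) (c : Fin p → K), (∃ j : Fin p, (j : ℕ) ≠ 0 ∧ c j ≠ 0) ∧
    ((∃ (d m : ℕ) (hmd : m ≤ d) (t : Fin d → ↥(locAtCentre A'.toSubring O)) (a : Fin m → ℕ) (u : ↥(locAtCentre A'.toSubring O)), IsUnit u ∧
    Ideal.span (Set.range t) = IsLocalRing.maximalIdeal ↥(locAtCentre A'.toSubring O) ∧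
    ringKrullDim ↥(locAtCentre A'.toSubring O) = (d : WithBot ℕ∞) ∧ 0 < m ∧ (∀ i, ¬ p ∣ a i) ∧
    (∑ j : Fin p, c j ^ p * g₀ ^ (j : ℕ)) = (u : K) * ∏ i : Fin m, ((t (Fin.castLE hmd i) : ↥(locAtCentre A'.toSubring O)) : K) ^ (a i)) ∨
    (∃ u : ↥(locAtCentre A'.toSubring O), IsUnit u ∧ (∑ j : Fin p, c j ^ p * g₀ ^ (j : ℕ)) = (u : K) ∧
    ∀ c' : ↥(locAtCentre A'.toSubring O), u - c' ^ p ∉ IsLocalRing.maximalIdeal ↥(locAtCentre A'.toSubring O)) ∨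
    (∃ s c' : ↥(locAtCentre A'.toSubring O), (∑ j : Fin p, c j ^ p * g₀ ^ (j : ℕ)) = (s : K) ∧
    s - c' ^ p ∈ IsLocalRing.maximalIdeal ↥(locAtCentre A'.toSubring O) ∧
    s - c' ^ p ∉ IsLocalRing.maximalIdeal ↥(locAtCentre A'.toSubring O) ^ 2)) :=
  cleanLU3Defect_of_heightOneCoarsening hEmb p hp k K O A hAO hAfg hfrac hreg hdim3 hzd g₀ hg₀ hdefect O₁ hOO₁ hO₁ hloc

/-- RECORD (v6): the general-divisorial (C-div) target is the tree theorem ✓ `cleanLU3Defect_of_divisorialCoarsening` (mod F-32 + F-78). [folklore] -/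
theorem Cdiv_divisorial_closed
    (hEmb : ∀ (Z : Scheme.{0}) [IsIntegral Z] [IsNoetherian Z], Scheme.IsRegular Z →
      Scheme.IsExcellent Z → ∀ (X : Set Z), IsClosed X → X ≠ Set.univ → topologicalKrullDim X ≤ 2 →
        ∃ (Z' : Scheme.{0}) (π : Z' ⟶ Z), IsProper π ∧ Function.Surjective π.base ∧
          (∃ U : Z.Opens, (U : Set Z) = Xᶜ ∧ IsIso (π ∣_ U)) ∧
          IsStrictNormalCrossingsDivisor Z' (π.base ⁻¹' X))
    (h78 : CossartJannsenSaito2020General.{0})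
    (p : ℕ) (hp : p.Prime) (k : Type) [Field k] [CharP k p] (K : Type) [Field K] [Algebra k K]
    (O : ValuationSubring K) (A : Subalgebra k K) (hAO : A.toSubring ≤ O.toSubring) (hAfg : A.FG)
    (hfrac : IsFractionRing A K)
    (hreg : IsRegularLocalRing (locAtCentre A.toSubring O))
    (hdim3 : ringKrullDim (locAtCentre A.toSubring O) = 3)
    (hzd : ∀ (T : Subring K) (hT : T ≤ O.toSubring), A.toSubring ≤ T → (subringCentre T O hT).IsMaximal)
    (g₀ : K) (hg₀ : ∀ c : K, c ^ p ≠ g₀)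
    (hdefect : ∀ f₀ : K, ∃ f₁ : K, O.valuation (g₀ - f₁ ^ p) < O.valuation (g₀ - f₀ ^ p))
    (O₁ : ValuationSubring K) (hOO₁ : O ≤ O₁) (hO₁ : O₁ ≠ ⊤)
    (y : Fin 2 → K) (hy : ∀ i, y i ∈ O)
    (hind : ∀ P : MvPolynomial (Fin 2) k, P ≠ 0 → O₁.valuation (MvPolynomial.aeval y P) = 1) :
    ∃ (A' : Subalgebra k K), A'.toSubring ≤ O.toSubring ∧ A ≤ A' ∧ A'.FG ∧
    ∃ (_ : IsRegularLocalRing (locAtCentre A'.toSubring O)) (c : Fin p → K), (∃ j : Fin p, (j : ℕ) ≠ 0 ∧ c j ≠ 0) ∧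
    ((∃ (d m : ℕ) (hmd : m ≤ d) (t : Fin d → ↥(locAtCentre A'.toSubring O)) (a : Fin m → ℕ) (u : ↥(locAtCentre A'.toSubring O)), IsUnit u ∧
    Ideal.span (Set.range t) = IsLocalRing.maximalIdeal ↥(locAtCentre A'.toSubring O) ∧
    ringKrullDim ↥(locAtCentre A'.toSubring O) = (d : WithBot ℕ∞) ∧ 0 < m ∧ (∀ i, ¬ p ∣ a i) ∧
    (∑ j : Fin p, c j ^ p * g₀ ^ (j : ℕ)) = (u : K) * ∏ i : Fin m, ((t (Fin.castLE hmd i) : ↥(locAtCentre A'.toSubring O)) : K) ^ (a i)) ∨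
    (∃ u : ↥(locAtCentre A'.toSubring O), IsUnit u ∧ (∑ j : Fin p, c j ^ p * g₀ ^ (j : ℕ)) = (u : K) ∧
    ∀ c' : ↥(locAtCentre A'.toSubring O), u - c' ^ p ∉ IsLocalRing.maximalIdeal ↥(locAtCentre A'.toSubring O)) ∨
    (∃ s c' : ↥(locAtCentre A'.toSubring O), (∑ j : Fin p, c j ^ p * g₀ ^ (j : ℕ)) = (s : K) ∧
    s - c' ^ p ∈ IsLocalRing.maximalIdeal ↥(locAtCentre A'.toSubring O) ∧
    s - c' ^ p ∉ IsLocalRing.maximalIdeal ↥(locAtCentre A'.toSubring O) ^ 2)) :=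
  cleanLU3Defect_of_divisorialCoarsening hEmb h78 p hp k K O A hAO hAfg hfrac hreg hdim3 hzd g₀ hg₀ hdefect O₁ hOO₁ hO₁ y hy hind

end Summit.ResolutionOfSingularities.ResolutionOfSingularities.Theorems.RadicialJung.CleanModels.CdivRecord

end
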